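import Mathlib
import Summits.Ventures.DiscreteObjects.Mahler.SmallMeasureCensus

/-!
# Palindromic (reciprocal) polynomials factor into reciprocal quadratics over `ℂ`

Cell `pub-namedobj`, seat `pub-namedobj-mahler-g2`, target (L). Framing: lottery ticket; floor = certified
bounds/negative ranges.

This closes the gap named in `ReciprocalCoeffBound.lean` / `PowerSumBound.lean`: the objects enumerated by the
census engines (monic integer polynomials of even degree `2d` with PALINDROMIC coefficients `a_j = a_{2d-j}`, the
"rec" family) have, over `ℂ`, the factorised shape `∏_{t ∈ s} (x² - t x + 1)` with `|s| = d` assumed by the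
soundness theorems for the pruning tests T1/T2.

* `trace_poly_exists`: for a palindromic `P` of degree `≤ 2d` over a field there is `Q` of degree `≤ d` with
  `P(x) = x^d · Q(x + x⁻¹)` for all `x ≠ 0` (root-free induction on `d`, peeling `a_{2d}(x^{2d} + 1)` with the
  Dickson polynomials `D_n(x + x⁻¹) = xⁿ + x⁻ⁿ` of Mathlib);
* `palindromic_factorisation`: a monic palindromic `P ∈ ℂ[x]` of degree `2d` equals
  `∏_{t ∈ Q.roots} (x² - t x + 1)`;
* `int_palindromic_factorisation`: the same for `P ∈ ℤ[x]` mapped to `ℂ`;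
* `exists_halfRoot`: `x² - t x + 1 = (x - α)(x - α⁻¹)` for some `α ≠ 0`, and
  `palindromic_halfRoots_factorisation`: `P = ∏_{α ∈ s'} (x - α)(x - α⁻¹)` (the shape used in `PowerSumBound`).
-/

namespace Summit.Ventures.DiscreteObjects.Mahler

open Polynomial

/-! ## Dickson polynomials `D_n = dickson 1 1 n`: degree and leading coefficient -/

/-- `natDegree (D_n) ≤ n`. -/
theorem dickson_one_one_natDegree_le {K : Type*} [CommRing K] [Nontrivial K] :
    ∀ n : ℕ, (dickson 1 (1 : K) n).natDegree ≤ n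
  | 0 => by
      rw [dickson_zero]
      norm_num
  | 1 => by rw [dickson_one]; exact natDegree_X_le
  | (n + 2) => by
      rw [dickson_add_two, map_one, one_mul]
      have h1 : (X * dickson 1 (1 : K) (n + 1)).natDegree ≤ n + 2 := by
        refine le_trans natDegree_mul_le ?_
        calc X.natDegree + (dickson 1 (1 : K) (n + 1)).natDegree ≤ 1 + (n + 1) :=
              add_le_add natDegree_X_le (dickson_one_one_natDegree_le (n + 1))
          _ = n + 2 := by ring
      have h2 : (dickson 1 (1 : K) n).natDegree ≤ n + 2 :=
        (dickson_one_one_natDegree_le n).trans (by omega)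
      exact (natDegree_sub_le_of_le h1 h2).trans (max_self _).le

/-- The coefficient of `x^n` in `D_n` is `1` for `n ≥ 1`. -/
theorem dickson_one_one_coeff_self {K : Type*} [CommRing K] [Nontrivial K] :
    ∀ n : ℕ, (dickson 1 (1 : K) (n + 1)).coeff (n + 1) = 1
  | 0 => by rw [dickson_one]; simp
  | (n + 1) => by
      rw [dickson_add_two, map_one, one_mul, coeff_sub, coeff_X_mul, dickson_one_one_coeff_self n,
        coeff_eq_zero_of_natDegree_lt (lt_of_le_of_lt (dickson_one_one_natDegree_le n) (by omega))]
      ring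

/-! ## The trace polynomial -/

/-- **Trace polynomial.** A palindromic polynomial `P` (`a_j = a_{2d-j}`, degree `≤ 2d`) over a field satisfies
`P(x) = x^d Q(x + x⁻¹)` (`x ≠ 0`) for some `Q` of degree `≤ d` whose `x^d`-coefficient is `a_{2d}`. -/
theorem trace_poly_exists {K : Type*} [Field K] : ∀ (d : ℕ) (P : K[X]), P.natDegree ≤ 2 * d →
    (∀ j ≤ 2 * d, P.coeff j = P.coeff (2 * d - j)) →
    ∃ Q : K[X], Q.natDegree ≤ d ∧ Q.coeff d = P.coeff (2 * d) ∧
      ∀ x : K, x ≠ 0 → P.eval x = x ^ d * Q.eval (x + x⁻¹)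
  | 0, P, hdeg, _ => by
      refine ⟨C (P.coeff 0), by simp, by simp, fun x _ => ?_⟩
      rw [eq_C_of_natDegree_le_zero hdeg]
      simp
  | (d + 1), P, hdeg, hpal => by
      set c := P.coeff (2 * (d + 1)) with hc
      set q : K[X] := P - C c * (X ^ (2 * (d + 1)) + 1) with hq
      set P'' := divX q with hP''
      have hcq : ∀ j, q.coeff j = P.coeff j - c * ((if j = 2 * (d + 1) then 1 else 0) + (if j = 0 then 1 else 0)) := by
        intro j
        rw [hq, coeff_sub, coeff_C_mul, coeff_add, coeff_X_pow, coeff_one]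
      have hc0 : P.coeff 0 = c := by
        rw [hc]; have := hpal 0 (by omega); simpa using this
      have hP''coeff : ∀ j, P''.coeff j = q.coeff (j + 1) := fun j => by rw [hP'', coeff_divX]
      -- degree of P''
      have hdeg'' : P''.natDegree ≤ 2 * d := by
        rw [natDegree_le_iff_coeff_eq_zero]
        intro j hj
        rw [hP''coeff, hcq]
        by_cases h1 : j + 1 = 2 * (d + 1)
        · rw [if_pos h1, if_neg (by omega), h1, ← hc]; ring
        · rw [if_neg h1, if_neg (by omega)]
          have : P.coeff (j + 1) = 0 := by
            apply coeff_eq_zero_of_natDegree_lt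
            have : (2 * d : ℕ) < j := by exact_mod_cast hj
            omega
          rw [this]; ring
      -- palindromicity of P''
      have hpal'' : ∀ j ≤ 2 * d, P''.coeff j = P''.coeff (2 * d - j) := by
        intro j hj
        rw [hP''coeff, hP''coeff, hcq, hcq, if_neg (by omega), if_neg (by omega), if_neg (by omega),
          if_neg (by omega)]
        have := hpal (j + 1) (by omega)
        rw [show 2 * (d + 1) - (j + 1) = 2 * d - j + 1 by omega] at this
        rw [this]
      obtain ⟨Q'', hQ''deg, hQ''coeff, hQ''eval⟩ := trace_poly_exists d P'' hdeg'' hpal''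
      refine ⟨C c * dickson 1 (1 : K) (d + 1) + Q'', ?_, ?_, ?_⟩
      · refine natDegree_add_le_of_degree_le (le_trans (natDegree_C_mul_le c _) ?_) (le_trans hQ''deg (by omega))
        exact dickson_one_one_natDegree_le (d + 1)
      · rw [coeff_add, coeff_C_mul, dickson_one_one_coeff_self d, mul_one,
          coeff_eq_zero_of_natDegree_lt (lt_of_le_of_lt hQ''deg (by omega)), add_zero]
      · intro x hx
        have hPq : P = P'' * X + C (q.coeff 0) + C c * (X ^ (2 * (d + 1)) + 1) := by
          rw [hP'', divX_mul_X_add, hq]; ring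
        have hq0 : q.coeff 0 = 0 := by
          rw [hcq, if_neg (by omega), if_pos rfl, hc0]; ring
        have hD := dickson_one_one_eval_add_inv x x⁻¹ (mul_inv_cancel₀ hx) (d + 1)
        rw [hPq, hq0, map_zero, add_zero]
        simp only [eval_add, eval_mul, eval_X, eval_C, eval_pow, eval_one, hD, hQ''eval x hx]
        have hxinv : x ^ (d + 1) * x⁻¹ ^ (d + 1) = 1 := by
          rw [← mul_pow, mul_inv_cancel₀ hx, one_pow]
        calc x ^ d * eval (x + x⁻¹) Q'' * x + c * (x ^ (2 * (d + 1)) + 1)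
            = x ^ (d + 1) * eval (x + x⁻¹) Q'' + c * (x ^ (d + 1) * x ^ (d + 1) +
                x ^ (d + 1) * x⁻¹ ^ (d + 1)) := by rw [hxinv]; ring
          _ = x ^ (d + 1) * (c * (x ^ (d + 1) + x⁻¹ ^ (d + 1)) + eval (x + x⁻¹) Q'') := by ring

/-! ## Factorisation over `ℂ` -/

/-- **Palindromic ⇒ product of reciprocal quadratics.** A monic `P ∈ ℂ[x]` of degree `2d` with palindromic
coefficients is `∏_{t ∈ s} (x² - t x + 1)` for a multiset `s` of cardinality `d` (the roots of its trace
polynomial). -/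
theorem palindromic_factorisation (P : ℂ[X]) (d : ℕ) (hmonic : P.Monic) (hdeg : P.natDegree = 2 * d)
    (hpal : ∀ j ≤ 2 * d, P.coeff j = P.coeff (2 * d - j)) :
    ∃ s : Multiset ℂ, Multiset.card s = d ∧ P = (s.map fun t => (X ^ 2 - C t * X + 1 : ℂ[X])).prod := by
  obtain ⟨Q, hQdeg, hQcoeff, hQeval⟩ := trace_poly_exists d P hdeg.le hpal
  have hlc : P.coeff (2 * d) = 1 := by rw [← hdeg]; exact hmonic
  rw [hlc] at hQcoeff
  have hQdeg' : Q.natDegree = d := by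
    refine le_antisymm hQdeg ?_
    exact le_natDegree_of_ne_zero (by rw [hQcoeff]; exact one_ne_zero)
  have hQmonic : Q.Monic := by
    rw [Monic, leadingCoeff, hQdeg', hQcoeff]
  have hsplit : Q = (Q.roots.map fun t => X - C t).prod :=
    (IsAlgClosed.splits Q).eq_prod_roots_of_monic hQmonic
  have hcard : Multiset.card Q.roots = d := by
    rw [← hQdeg']
    exact (splits_iff_card_roots.mp (IsAlgClosed.splits Q))
  refine ⟨Q.roots, hcard, ?_⟩
  apply Polynomial.funext
  intro x
  rcases eq_or_ne x 0 with rfl | hx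
  · -- both sides evaluate to 1 at 0
    rw [eval_multiset_prod, Multiset.map_map]
    have h0 : P.eval 0 = 1 := by
      rw [← coeff_zero_eq_eval_zero]
      have := hpal 0 (by omega)
      rw [this, Nat.sub_zero, hlc]
    rw [h0]
    have : (Q.roots.map ((fun p : ℂ[X] => p.eval 0) ∘ fun t => (X ^ 2 - C t * X + 1 : ℂ[X]))) =
        Q.roots.map (fun _ => (1 : ℂ)) := Multiset.map_congr rfl fun t _ => by simp
    rw [this, Multiset.map_const', Multiset.prod_replicate, one_pow]
  · rw [hQeval x hx, eval_multiset_prod, Multiset.map_map]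
    conv_lhs => rw [hsplit, eval_multiset_prod, Multiset.map_map]
    -- x^d * ∏ (y - t) = ∏ (x * (y - t)) = ∏ (x² - t x + 1)
    rw [← hcard, ← Multiset.prod_replicate, ← Multiset.map_const', ← Multiset.prod_map_mul]
    congr 1
    apply Multiset.map_congr rfl
    intro t _
    simp only [Function.comp_apply, eval_sub, eval_X, eval_C, eval_add, eval_mul, eval_pow, eval_one]
    field_simp
    ring

/-- Integer version: a monic palindromic `P ∈ ℤ[x]` of degree `2d`, mapped to `ℂ`, is a product of `d`
reciprocal quadratics `x² - t x + 1`. This is exactly the "rec" family enumerated by the census engines. -/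
theorem int_palindromic_factorisation (P : ℤ[X]) (d : ℕ) (hmonic : P.Monic) (hdeg : P.natDegree = 2 * d)
    (hpal : ∀ j ≤ 2 * d, P.coeff j = P.coeff (2 * d - j)) :
    ∃ s : Multiset ℂ, Multiset.card s = d ∧
      P.map (Int.castRingHom ℂ) = (s.map fun t => (X ^ 2 - C t * X + 1 : ℂ[X])).prod := by
  apply palindromic_factorisation
  · exact hmonic.map _
  · rw [natDegree_map_eq_of_injective (Int.castRingHom ℂ).injective_int, hdeg]
  · intro j hj
    rw [coeff_map, coeff_map, hpal j hj]

/-! ## Half-roots -/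

/-- Every reciprocal quadratic splits as `(x - α)(x - α⁻¹)` with `α ≠ 0`. -/
theorem exists_halfRoot (t : ℂ) :
    ∃ α : ℂ, α ≠ 0 ∧ (X ^ 2 - C t * X + 1 : ℂ[X]) = (X - C α) * (X - C α⁻¹) := by
  have hdeg : (X ^ 2 - C t * X + 1 : ℂ[X]).degree = 2 := by compute_degree!
  obtain ⟨α, hα⟩ := IsAlgClosed.exists_root (X ^ 2 - C t * X + 1 : ℂ[X]) (by rw [hdeg]; norm_num)
  have hroot : α ^ 2 - t * α + 1 = 0 := by simpa using hα.eq_zero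
  have hα0 : α ≠ 0 := by
    intro h; rw [h] at hroot; norm_num at hroot
  have hinv : α⁻¹ = t - α := by
    have h1 : α * (t - α) = 1 := by linear_combination (-1 : ℂ) * hroot
    exact inv_eq_of_mul_eq_one_right h1
  refine ⟨α, hα0, ?_⟩
  have : (X - C α) * (X - C α⁻¹) = X ^ 2 - C (α + α⁻¹) * X + C (α * α⁻¹) := by
    rw [map_add, map_mul]; ring
  rw [this, mul_inv_cancel₀ hα0, map_one, hinv, show α + (t - α) = t by ring]

/-- The factorisation in half-root form: `P = ∏_{α ∈ s'} (x - α)(x - α⁻¹)` with all `α ≠ 0`, `|s'| = d`. -/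
theorem palindromic_halfRoots_factorisation (P : ℂ[X]) (d : ℕ) (hmonic : P.Monic)
    (hdeg : P.natDegree = 2 * d) (hpal : ∀ j ≤ 2 * d, P.coeff j = P.coeff (2 * d - j)) :
    ∃ s' : Multiset ℂ, Multiset.card s' = d ∧ (∀ α ∈ s', α ≠ 0) ∧
      P = (s'.map fun α => ((X - C α) * (X - C α⁻¹) : ℂ[X])).prod := by
  obtain ⟨s, hcard, hP⟩ := palindromic_factorisation P d hmonic hdeg hpal
  choose f hf0 hff using exists_halfRoot
  refine ⟨s.map f, by rw [Multiset.card_map, hcard], ?_, ?_⟩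
  · intro α hα
    obtain ⟨t, _, rfl⟩ := Multiset.mem_map.mp hα
    exact hf0 t
  · rw [hP, Multiset.map_map]
    congr 1
    exact Multiset.map_congr rfl fun t _ => hff t

end Summit.Ventures.DiscreteObjects.Mahler
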